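import Summits.ValiantsHypothesis.ValiantsHypothesis.Theorems.NewtonFramesTwoProductsFrameRungTwoTorsionSep

/-!
# Crux `TwoProducts` (stmt-5906), line `FrameRungTwo`: cancellation is AUTOMATIC on the integral span (the exact residual is torsion)

Named form of the algebra inside `sep1D_of_noTorsion1D` (`…TorsionSep.lean`, p641945), as asked by the critic of record
(val-idea-crit-3 g4, 2026-08-28T14:28Z): `cancel_of_integral_span` — if the top relation `Σ_j [a_j] − Σ_j [u_j]` lies in the ℤ-SPAN
of the lower relations `[b] − [c]` (light common points `Σ b = Σ c ≠ e`), then ANY letter weights that are nonzero on the letters and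
cancel at those points cancel at `e`: each lower relation evaluates to `−1` under the weights, the S-letter count of every relation is
`m`, so the integer coefficients sum to `1` and the top relation evaluates to `−1`.  No dissociation, window or depth hypothesis beyond
`4 ≤ #demoted letters of a` (only used for `m ≠ 0`).  Consequently the cancellation kernel `hCancel1D` is GENUINELY at stake only at a
windowed deep–deep pair whose top relation is torsion-but-not-integral over the light relations (none among ≈ 10⁵ pairs tested,
memo-IX-g4 §2) — the statement `hNoTors1DGuarded` of `…TorsionGuarded.lean` names exactly that residual.
Honest scope: an algebraic lemma for ONE stub of a rung strictly below the crux `TwoProducts`; nothing here bears on `VP ≠ VNP`.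
[ours; setting KPTT arXiv:1308.2286 §2, §5]
-/

set_option linter.dupNamespace false

namespace Summit.ValiantsHypothesis.ValiantsHypothesis.Theorems.NewtonFramesTwoProducts.FrameRungTwoTrinomial

open scoped BigOperators Classical

noncomputable section

section IntegralSpan

variable {m : ℕ}

/-- **Cancellation is automatic on the integral span.**  If the top relation is an INTEGER combination of the lower light relations,
letter weights cancelling at the light common points other than `e` cancel at `e`. [ours] -/
theorem cancel_of_integral_span (S S' : Fin m → Finset ℝ) (e : ℝ) (T a u : Fin m → ℝ) (cf cg : Fin m → ℝ → ℂ)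
    (ha : ∀ j, a j ∈ S j) (hu : ∀ j, u j ∈ S' j)
    (h4 : 4 ≤ (Finset.univ.filter fun i => a i ≠ T i).card)
    (hcf : ∀ j, ∀ x ∈ S j, cf j x ≠ 0) (hcg : ∀ j, ∀ x ∈ S' j, cg j x ≠ 0)
    (hcan : ∀ b c : Fin m → ℝ, (∀ j, b j ∈ S j) → (∀ j, c j ∈ S' j) → ∑ j, b j = ∑ j, c j →
      ∑ j, b j ≠ e → e ≤ ∑ j, b j → ∏ j, cf j (b j) + ∏ j, cg j (c j) = 0)
    (hint : ((∑ j, Finsupp.single (Sum.inl (j, a j)) (1 : ℤ)) - ∑ j, Finsupp.single (Sum.inr (j, u j)) (1 : ℤ) :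
          (Fin m × ℝ) ⊕ (Fin m × ℝ) →₀ ℤ) ∈
        Submodule.span ℤ ((((Fintype.piFinset S ×ˢ Fintype.piFinset S').filter fun bc =>
            ∑ j, bc.1 j = ∑ j, bc.2 j ∧ ∑ j, bc.1 j ≠ e ∧ e ≤ ∑ j, bc.1 j).image fun bc =>
            ((∑ j, Finsupp.single (Sum.inl (j, bc.1 j)) (1 : ℤ)) - ∑ j, Finsupp.single (Sum.inr (j, bc.2 j)) (1 : ℤ) :
              (Fin m × ℝ) ⊕ (Fin m × ℝ) →₀ ℤ)) : Set ((Fin m × ℝ) ⊕ (Fin m × ℝ) →₀ ℤ))) :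
    ∏ j, cf j (a j) + ∏ j, cg j (u j) = 0 := by
  set vZ : (Fin m → ℝ) → (Fin m → ℝ) → ((Fin m × ℝ) ⊕ (Fin m × ℝ) →₀ ℤ) := fun b c =>
    (∑ j, Finsupp.single (Sum.inl (j, b j)) (1 : ℤ)) - ∑ j, Finsupp.single (Sum.inr (j, c j)) (1 : ℤ) with hvZ
  set Prs := (Fintype.piFinset S ×ˢ Fintype.piFinset S').filter fun bc =>
    ∑ j, bc.1 j = ∑ j, bc.2 j ∧ ∑ j, bc.1 j ≠ e ∧ e ≤ ∑ j, bc.1 j with hPrs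
  set RZ := Prs.image fun bc => vZ bc.1 bc.2 with hRZ
  have hPrs_mem : ∀ bc ∈ Prs, (∀ j, bc.1 j ∈ S j) ∧ (∀ j, bc.2 j ∈ S' j) ∧ ∑ j, bc.1 j = ∑ j, bc.2 j ∧
      ∑ j, bc.1 j ≠ e ∧ e ≤ ∑ j, bc.1 j := by
    intro bc hbc
    rw [hPrs, Finset.mem_filter, Finset.mem_product] at hbc
    exact ⟨Fintype.mem_piFinset.1 hbc.1.1, Fintype.mem_piFinset.1 hbc.1.2, hbc.2.1, hbc.2.2.1, hbc.2.2.2⟩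
  have hrZ : vZ a u ∈ Submodule.span ℤ (RZ : Set ((Fin m × ℝ) ⊕ (Fin m × ℝ) →₀ ℤ)) := hint
  rw [Submodule.mem_span_finset] at hrZ
  obtain ⟨kZ, -, hkZ⟩ := hrZ
  by_contra hne
  set w : (Fin m × ℝ) ⊕ (Fin m × ℝ) → ℂ := fun ℓ => Sum.elim (fun p => if p.2 ∈ S p.1 then cf p.1 p.2 else 1)
    (fun p => if p.2 ∈ S' p.1 then cg p.1 p.2 else 1) ℓ with hwdef
  have hw : ∀ ℓ, w ℓ ≠ 0 := by
    rintro (p | p) <;> simp only [hwdef, Sum.elim_inl, Sum.elim_inr] <;> split_ifs with h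
    exacts [hcf p.1 p.2 h, one_ne_zero, hcg p.1 p.2 h, one_ne_zero]
  have hevS : ∀ b : Fin m → ℝ, (∀ j, b j ∈ S j) →
      Finsupp.prod (∑ j, Finsupp.single (Sum.inl (j, b j)) (1 : ℤ)) (fun ℓ n => w ℓ ^ n) = ∏ j, cf j (b j) := by
    intro b hb
    rw [evalZ_sum_single w hw]
    exact Finset.prod_congr rfl fun j _ => by simp only [hwdef, Sum.elim_inl, if_pos (hb j)]
  have hevS' : ∀ c : Fin m → ℝ, (∀ j, c j ∈ S' j) →
      Finsupp.prod (∑ j, Finsupp.single (Sum.inr (j, c j)) (1 : ℤ)) (fun ℓ n => w ℓ ^ n) = ∏ j, cg j (c j) := by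
    intro c hc
    rw [evalZ_sum_single w hw]
    exact Finset.prod_congr rfl fun j _ => by simp only [hwdef, Sum.elim_inr, if_pos (hc j)]
  have hev : ∀ b c : Fin m → ℝ, (∀ j, b j ∈ S j) → (∀ j, c j ∈ S' j) →
      Finsupp.prod (vZ b c) (fun ℓ n => w ℓ ^ n) = (∏ j, cf j (b j)) * (∏ j, cg j (c j))⁻¹ := by
    intro b c hb hc
    simp only [hvZ]
    rw [sub_eq_add_neg, evalZ_add w hw, evalZ_neg w hw, hevS b hb, hevS' c hc]
  have hevR : ∀ ρZ ∈ RZ, Finsupp.prod ρZ (fun ℓ n => w ℓ ^ n) = -1 := by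
    intro ρZ hρ
    rw [hRZ] at hρ
    obtain ⟨bc, hbc, rfl⟩ := Finset.mem_image.1 hρ
    obtain ⟨hb, hc, hs, hne', hle⟩ := hPrs_mem bc hbc
    rw [hev bc.1 bc.2 hb hc]
    have h0 : ∏ j, cg j (bc.2 j) ≠ 0 := Finset.prod_ne_zero_iff.2 fun j _ => hcg j _ (hc j)
    have h1 := hcan bc.1 bc.2 hb hc hs hne' hle
    field_simp
    linear_combination h1
  -- letter count on the S side
  set μ : ((Fin m × ℝ) ⊕ (Fin m × ℝ) →₀ ℤ) →+ ℤ :=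
    Finsupp.liftAddHom fun ℓ => Sum.elim (fun _ => AddMonoidHom.id ℤ) (fun _ => 0) ℓ with hμ
  have hμv : ∀ b c : Fin m → ℝ, μ (vZ b c) = m := by
    intro b c
    simp only [hvZ, map_sub, map_sum, hμ, Finsupp.liftAddHom_apply_single, Sum.elim_inl, Sum.elim_inr,
      AddMonoidHom.id_apply, AddMonoidHom.zero_apply, Finset.sum_const_zero, sub_zero, Finset.sum_const,
      Finset.card_univ, Fintype.card_fin, nsmul_eq_mul, mul_one]
  have hμR : ∀ ρZ ∈ RZ, μ ρZ = m := by
    intro ρZ hρ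
    rw [hRZ] at hρ
    obtain ⟨bc, _, rfl⟩ := Finset.mem_image.1 hρ
    exact hμv bc.1 bc.2
  have hsumk : (∑ ρZ ∈ RZ, kZ ρZ) * (m : ℤ) = m := by
    have h := congrArg μ hkZ
    rw [map_sum, hμv] at h
    rw [Finset.sum_mul]
    calc ∑ ρZ ∈ RZ, kZ ρZ * (m : ℤ) = ∑ ρZ ∈ RZ, μ (kZ ρZ • ρZ) :=
          Finset.sum_congr rfl fun ρZ hρ => by rw [map_zsmul, hμR ρZ hρ, smul_eq_mul]
      _ = m := h
  have hm0 : (m : ℤ) ≠ 0 := by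
    have : 4 ≤ m := h4.trans ((Finset.card_filter_le _ _).trans (by rw [Finset.card_fin]))
    omega
  have hk1 : ∑ ρZ ∈ RZ, kZ ρZ = 1 := by
    have h : (∑ ρZ ∈ RZ, kZ ρZ - 1) * (m : ℤ) = 0 := by rw [sub_mul, hsumk, one_mul, sub_self]
    rcases mul_eq_zero.1 h with h | h
    · linarith
    · exact absurd h hm0
  -- evaluate the integer identity
  have hE := congrArg (fun v => Finsupp.prod v (fun ℓ n => w ℓ ^ n)) hkZ
  rw [evalZ_sum_zsmul w hw, hev a u ha hu] at hE
  have hE' : ∏ ρZ ∈ RZ, Finsupp.prod ρZ (fun ℓ n => w ℓ ^ n) ^ kZ ρZ = -1 := by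
    rw [Finset.prod_congr rfl fun ρZ hρ => by rw [hevR ρZ hρ], prod_neg_one_zpow, hk1, zpow_one]
  rw [hE'] at hE
  have hu0 : ∏ j, cg j (u j) ≠ 0 := Finset.prod_ne_zero_iff.2 fun j _ => hcg j _ (hu j)
  apply hne
  have : ∏ j, cf j (a j) = -∏ j, cg j (u j) := by
    have h := hE.symm
    field_simp at h
    linear_combination h
  rw [this]; ring

end IntegralSpan

end

end Summit.ValiantsHypothesis.ValiantsHypothesis.Theorems.NewtonFramesTwoProducts.FrameRungTwoTrinomial
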